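import Summits.Ventures.QEC.Census.BB.SD8Rows04
import Summits.Ventures.QEC.Census.BB.BBRows
import Summits.Ventures.QEC.Census.BB.Claims
import Literature.InformationTheory.QuantumCodes.TwoBlockConnectedComponents
import Literature.InformationTheory.QuantumCodes.TwoBlockToricLayout
import Literature.InformationTheory.QuantumCodes.TwoBlockWheelComponents
import Literature.InformationTheory.QuantumCodes.TwoBlockRootParameters
import HarnessLib
import HarnessLib.Audit.Tags

/-!
# Census rows as TYPED two-block codes `QC(A, B)` on `ℤ_ℓ × ℤ_m` — bridge batch `SD8RowsQC6` (2 row(s), kernel tier)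

Family: abelian two-block over ℤ_ℓ × ℤ_m (qec census one-module KERNEL-std rows: qec-search-7 certificate modules, MITM and
Brouwer–Zimmermann/automorphism formats). For each census row below (an EXPLICIT matrix code
`cert.code _ = CSSCode.ofMatrices (rowMatrix n cert.HX) (rowMatrix n cert.HZ)` with `IsCode n k d` certified in its own module), this file
puts the row's CONSTRUCTION into the kernel statement, as in the pilot `Census/BB/A1s_n144_k32_4addf704QC.lean` (p511732) and the
gen-4 batches `A1sRowsQC1–5` / `TwoBGARowsQC1–4`: monomial lists `la`, `lb` (from the certificate's construction record — the
docstring's `A_terms`/`B_terms` or the census row id `2bga-lℓmm-A…-B…`, monomials `xⁱyʲ` as `[i,j]`, convention of BCGMRY24 §4 =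
`BivariateBicycleCodes.lean`; the index identity was ALSO re-verified row-for-row by the emitter before filing), the typed object
`qc : BB.Code ℓ m := ⟨polyL la, polyL lb⟩`, the kernel INDEX IDENTITIES `cert.HX = BBRows.rowsX la lb`, `cert.HZ = BBRows.rowsZ la lb`
(`decide`; verified row generator `Census/BB/BBRows.lean`, p502918), the flat identities via `BBRows.rowMatrix_rowsX/Z`, the transport of
the row's own `dZ_eq` and `k` (its `k_eq`, or the `k`-component of its `isCode`) by type-05's `BB.Code.dZ_eq_of_flat` / `k_eq_of_flat` to
`qc_hasParams : BB.HasParams qc n k d` (census predicate of family BB, `Census/BB/Claims.lean`, distance EXACT) and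
`qc_isCode : qc.css.IsCode n k d`; and the census LAYOUT columns (Bravyi et al. 2024 §4 — arXiv:2308.07915: Lemma 2 p0010 L49, Lemma 3 p0011 L9, Lemma 4 p0011 L28; locators per qec-ref-2 2026-08-27T10:27Z) as KERNEL verdicts: «connected» —
`qc_tannerGraph_connected` (Lemma 3, `BB.Code.tannerGraph_connected_of_unit_mem`, explicit multiples of exponent differences) or
`qc_tannerGraph_not_connected` + `card_expDiffSubgroup` + `qc_card_connectedComponent` (`⟨S⟩` = an explicit finite carrier `diffList`,
both inclusions certified; exact component count by Lemma 3 (ii), `BB.Code.card_connectedComponent_mul_card`; by the tree's connected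
normal form `TwoBlockConnectedComponents.lean` such a code is the disjoint union of that many copies of its root code, whose parameters
`[[n/c, k/c, d]]` and connectedness are certified here as `root_isCode` via `TwoBlockRootParameters.lean`); «toric layout» —
`qc_hasToricLayoutWith μ λ` (Lemma 4, `BB.Code.hasToricLayoutWith_of_exponents`; omitted when its sufficient condition has no witness);
«wheel layers» — `qc_wheel_layers` (Lemma 2 minus planarity, `BB.Code.exists_wheel_layers`, weight-(3,3) rows only):

* `SD8lc_n48_k16_503a67c3` = `QC(1 + y^2 + y^6 + xy^2, 1 + y^6 + y^10 + xy^10)` on `ℤ_2 × ℤ_12`: `[[48, 16, 4]]`; Tanner graph NOT connected: |⟨S⟩| = 12, 2 components (= 2 × [[24, 8, 4]] — root code KERNEL `root_isCode`)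
* `SD8lc_n36_k10_ab93baab` = `QC(1 + y + x + xy^2, 1 + y^5 + x^2 + x^2y^4)` on `ℤ_3 × ℤ_6`: `[[36, 10, 4]]`; Tanner graph connected; toric layout (6,3)

No new certificate — tier KERNEL, axioms standard, no `native_decide`. HONEST FRAMING: identifies already-certified census objects with
named algebraic constructions and decides structural (graph) properties; the census comparator columns (printed values, optimality
words) are not touched; for disconnected rows the root code is identified abstractly over `↥⟨S⟩` (not re-indexed to a named `QC(A',B')`,
not identified with a smaller census row); planarity/thickness is not asserted. Generated by
qec-type-05 gen 5's `tools/emit_qc_bridge2.py` + `tools/conn_cert.py` (HOME/lean/type-05/tools/).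
-/

namespace Summit.Ventures.QEC.Census.SD8lc_n48_k16_503a67c3

open Matrix Literature.InformationTheory.QuantumCodes BBRows

/-- Monomials of `A = 1 + y^2 + y^6 + xy^2` (construction `A_terms = [[0, 0], [0, 2], [0, 6], [1, 2]]`, from the census generator file `census/search-3/gens/sd8/SD8lc_n48_k16_503a67c3.json` (matrix_sha256 `503a67c3eeeeaaba…`; `A = 1+y^2+y^6+x*y^2`, `B = 1+y^6+y^10+x*y^10`)). DATA. -/
def la : List (BB.Mono 2 12) := [(Fin.ofNat 2 0, Fin.ofNat 12 0), (Fin.ofNat 2 0, Fin.ofNat 12 2), (Fin.ofNat 2 0, Fin.ofNat 12 6), (Fin.ofNat 2 1, Fin.ofNat 12 2)]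

/-- Monomials of `B = 1 + y^6 + y^10 + xy^10` (construction `B_terms = [[0, 0], [0, 6], [0, 10], [1, 10]]`). DATA. -/
def lb : List (BB.Mono 2 12) := [(Fin.ofNat 2 0, Fin.ofNat 12 0), (Fin.ofNat 2 0, Fin.ofNat 12 6), (Fin.ofNat 2 0, Fin.ofNat 12 10), (Fin.ofNat 2 1, Fin.ofNat 12 10)]

/-- The census row's code as a TYPED two-block code `QC(1 + y^2 + y^6 + xy^2, 1 + y^6 + y^10 + xy^10)` on `ℤ_2 × ℤ_12` (`BB.Code 2 12`). (definition) -/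
def qc : BB.Code 2 12 := ⟨polyL la, polyL lb⟩

set_option maxRecDepth 100000 in
/-- INDEX IDENTITY, `X` side, in the kernel: the certificate's `H^X` rows ARE the `X`-check words of `qc` (`decide +kernel`). -/
theorem HX_eq_rowsX : SD8lc_n48_k16_503a67c3.cert.HX = rowsX la lb := by
  decide +kernel

set_option maxRecDepth 100000 in
/-- INDEX IDENTITY, `Z` side. -/
theorem HZ_eq_rowsZ : SD8lc_n48_k16_503a67c3.cert.HZ = rowsZ la lb := by
  decide +kernel

set_option maxRecDepth 100000 in
/-- The certificate's flat `H^X` is `qc.HXFlat`. -/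
theorem rowMatrix_HX_eq : rowMatrix 48 SD8lc_n48_k16_503a67c3.cert.HX = qc.HXFlat := by
  have cast : ∀ {H H' : List ℕ} (e : H = H'),
      rowMatrix 48 H = (rowMatrix 48 H').submatrix (Fin.cast (congrArg List.length e)) id := by
    intro H H' e; subst e; rfl
  exact (cast HX_eq_rowsX).trans (rowMatrix_rowsX qc (LA := la) (LB := lb) rfl rfl)

set_option maxRecDepth 100000 in
/-- The certificate's flat `H^Z` is `qc.HZFlat`. -/
theorem rowMatrix_HZ_eq : rowMatrix 48 SD8lc_n48_k16_503a67c3.cert.HZ = qc.HZFlat := by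
  have cast : ∀ {H H' : List ℕ} (e : H = H'),
      rowMatrix 48 H = (rowMatrix 48 H').submatrix (Fin.cast (congrArg List.length e)) id := by
    intro H H' e; subst e; rfl
  exact (cast HZ_eq_rowsZ).trans (rowMatrix_rowsZ qc (LA := la) (LB := lb) rfl rfl)

set_option maxRecDepth 100000 in
/-- `d^Z (qc) = 4`, transported from the census certificate (`SD8lc_n48_k16_503a67c3.dZ_eq`) by `BB.Code.dZ_eq_of_flat`. -/
theorem qc_dZ : qc.css.dZ = 4 :=
  (qc.dZ_eq_of_flat (D := SD8lc_n48_k16_503a67c3.cert.code SD8lc_n48_k16_503a67c3.commOK_cert)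
    rowMatrix_HX_eq rowMatrix_HZ_eq).symm.trans SD8lc_n48_k16_503a67c3.dZ_eq

set_option maxRecDepth 100000 in
/-- `k (qc) = 16`, transported from the census certificate (`SD8lc_n48_k16_503a67c3.k_eq`) by `BB.Code.k_eq_of_flat`. -/
theorem qc_k : qc.k = 16 :=
  (qc.k_eq_of_flat (D := SD8lc_n48_k16_503a67c3.cert.code SD8lc_n48_k16_503a67c3.commOK_cert)
    rowMatrix_HX_eq rowMatrix_HZ_eq).symm.trans SD8lc_n48_k16_503a67c3.k_eq

/-- **`QC(1 + y^2 + y^6 + xy^2, 1 + y^6 + y^10 + xy^10)` on `ℤ_2 × ℤ_12` has parameters `[[48, 16, 4]]`** (distance exact; `BB.HasParams`) — the census row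
`SD8lc_n48_k16_503a67c3` read as a statement about the construction. KERNEL. -/
theorem qc_hasParams : Summit.Ventures.QEC.BB.HasParams qc 48 16 4 :=
  BB.hasParams_of_dZ (by simp only [BB.numQubits_eq]) qc_k qc_dZ

/-- The same in the generic census vocabulary: `qc.css.IsCode 48 16 4`. -/
theorem qc_isCode : qc.css.IsCode 48 16 4 :=
  (BB.hasParams_iff_isCode (by decide)).1 qc_hasParams

/-! ### Connectivity: this row is DISCONNECTED (`|⟨S⟩| = 12` of `ℓm = 24` ⇒ `2` components by Lemma 3 (ii)) -/

/-- The exponent-difference subgroup `⟨S⟩` of `qc` as an explicit finite carrier (12 elements, closed under `0, +, −` —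
computed by tools/conn_cert.py, closure re-checked by `decide` below). DATA. -/
def diffList : List (BB.Mono 2 12) := [((0 : Fin 2), (0 : Fin 12)), ((0 : Fin 2), (2 : Fin 12)), ((0 : Fin 2), (4 : Fin 12)), ((0 : Fin 2), (6 : Fin 12)), ((0 : Fin 2), (8 : Fin 12)), ((0 : Fin 2), (10 : Fin 12)), ((1 : Fin 2), (0 : Fin 12)), ((1 : Fin 2), (2 : Fin 12)), ((1 : Fin 2), (4 : Fin 12)), ((1 : Fin 2), (6 : Fin 12)), ((1 : Fin 2), (8 : Fin 12)), ((1 : Fin 2), (10 : Fin 12))]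

set_option maxRecDepth 100000 in
/-- `diffList` contains `0`, is closed under addition and under negation (`decide`). -/
theorem diffList_closed : (((0 : Fin 2), (0 : Fin 12)) : BB.Mono 2 12) ∈ diffList ∧
    (∀ a b : BB.Mono 2 12, a ∈ diffList → b ∈ diffList → a + b ∈ diffList) ∧
    (∀ a : BB.Mono 2 12, a ∈ diffList → -a ∈ diffList) := by
  refine ⟨by decide +kernel, by decide +kernel, by decide +kernel⟩

/-- `⟨S⟩` as an additive subgroup with carrier `diffList`. (definition) -/
def diffSub : AddSubgroup (BB.Mono 2 12) where
  carrier := {x | x ∈ diffList}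
  zero_mem' := diffList_closed.1
  add_mem' := fun {a b} ha hb => diffList_closed.2.1 a b ha hb
  neg_mem' := fun {a} ha => diffList_closed.2.2 a ha

set_option maxRecDepth 100000 in
/-- Every exponent difference inside `A` and inside `B` lies in `diffList` (`decide` over all pairs of `ℤ_2 × ℤ_12`). -/
theorem diffs_mem : (∀ g g' : BB.Mono 2 12, qc.A g ≠ 0 → qc.A g' ≠ 0 → g - g' ∈ diffList) ∧
    (∀ g g' : BB.Mono 2 12, qc.B g ≠ 0 → qc.B g' ≠ 0 → g - g' ∈ diffList) := by
  refine ⟨by decide +kernel, by decide +kernel⟩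

/-- Hence `expDiffSubgroup qc ≤ diffSub`. -/
theorem expDiffSubgroup_le : qc.expDiffSubgroup ≤ diffSub :=
  (AddSubgroup.closure_le diffSub).2 (by
    rintro d (⟨g, g', hg, hg', rfl⟩ | ⟨g, g', hg, hg', rfl⟩)
    · exact diffs_mem.1 g g' hg hg'
    · exact diffs_mem.2 g g' hg hg')

set_option maxRecDepth 100000 in
/-- **The Tanner graph of `qc` is NOT connected** (Bravyi et al. 2024 Lemma 3: `⟨S⟩ ≠ ℤ_2 × ℤ_12` — the element
`(0, 1)` is not an exponent-difference combination). Census column «connected» = false for this row, KERNEL. -/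
theorem qc_tannerGraph_not_connected : ¬ qc.css.tannerGraph.Connected := fun h => by
  have htop := (qc.tannerGraph_connected_iff (fun h => absurd (congrFun h ((0 : Fin 2), (0 : Fin 12))) (by decide))
    (fun h => absurd (congrFun h ((0 : Fin 2), (0 : Fin 12))) (by decide))).1 h
  have hx : (((0 : Fin 2), (1 : Fin 12)) : BB.Mono 2 12) ∈ diffSub := expDiffSubgroup_le (htop ▸ AddSubgroup.mem_top _)
  have hx' : (((0 : Fin 2), (1 : Fin 12)) : BB.Mono 2 12) ∈ diffList := hx
  exact absurd hx' (by decide)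

set_option maxRecDepth 100000 in
/-- Conversely every element of `diffList` IS an exponent-difference combination (BFS certificate from `0`: each element = an
earlier one + one difference inside `A` or `B`; tools/conn_cert.py), so `⟨S⟩ = diffSub` exactly. -/
theorem diffList_le : ∀ x : BB.Mono 2 12, x ∈ diffList → x ∈ qc.expDiffSubgroup := by
  have m0 : (((0 : Fin 2), (0 : Fin 12)) : BB.Mono 2 12) ∈ qc.expDiffSubgroup := qc.expDiffSubgroup.zero_mem
  have m1 : (((0 : Fin 2), (10 : Fin 12)) : BB.Mono 2 12) ∈ qc.expDiffSubgroup := by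
    have e : (((0 : Fin 2), (10 : Fin 12)) : BB.Mono 2 12) =
        ((0 : Fin 2), (0 : Fin 12)) + ((((0 : Fin 2), (0 : Fin 12))) - (0, 2)) := by decide
    rw [e]
    exact qc.expDiffSubgroup.add_mem m0 (qc.sub_mem_expDiffSubgroup_A (by decide) (by decide))
  have m2 : (((0 : Fin 2), (6 : Fin 12)) : BB.Mono 2 12) ∈ qc.expDiffSubgroup := by
    have e : (((0 : Fin 2), (6 : Fin 12)) : BB.Mono 2 12) =
        ((0 : Fin 2), (0 : Fin 12)) + ((((0 : Fin 2), (0 : Fin 12))) - (0, 6)) := by decide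
    rw [e]
    exact qc.expDiffSubgroup.add_mem m0 (qc.sub_mem_expDiffSubgroup_A (by decide) (by decide))
  have m3 : (((1 : Fin 2), (10 : Fin 12)) : BB.Mono 2 12) ∈ qc.expDiffSubgroup := by
    have e : (((1 : Fin 2), (10 : Fin 12)) : BB.Mono 2 12) =
        ((0 : Fin 2), (0 : Fin 12)) + ((((0 : Fin 2), (0 : Fin 12))) - (1, 2)) := by decide
    rw [e]
    exact qc.expDiffSubgroup.add_mem m0 (qc.sub_mem_expDiffSubgroup_A (by decide) (by decide))
  have m4 : (((0 : Fin 2), (2 : Fin 12)) : BB.Mono 2 12) ∈ qc.expDiffSubgroup := by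
    have e : (((0 : Fin 2), (2 : Fin 12)) : BB.Mono 2 12) =
        ((0 : Fin 2), (0 : Fin 12)) + ((((0 : Fin 2), (2 : Fin 12))) - (0, 0)) := by decide
    rw [e]
    exact qc.expDiffSubgroup.add_mem m0 (qc.sub_mem_expDiffSubgroup_A (by decide) (by decide))
  have m5 : (((0 : Fin 2), (8 : Fin 12)) : BB.Mono 2 12) ∈ qc.expDiffSubgroup := by
    have e : (((0 : Fin 2), (8 : Fin 12)) : BB.Mono 2 12) =
        ((0 : Fin 2), (0 : Fin 12)) + ((((0 : Fin 2), (2 : Fin 12))) - (0, 6)) := by decide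
    rw [e]
    exact qc.expDiffSubgroup.add_mem m0 (qc.sub_mem_expDiffSubgroup_A (by decide) (by decide))
  have m6 : (((1 : Fin 2), (0 : Fin 12)) : BB.Mono 2 12) ∈ qc.expDiffSubgroup := by
    have e : (((1 : Fin 2), (0 : Fin 12)) : BB.Mono 2 12) =
        ((0 : Fin 2), (0 : Fin 12)) + ((((0 : Fin 2), (2 : Fin 12))) - (1, 2)) := by decide
    rw [e]
    exact qc.expDiffSubgroup.add_mem m0 (qc.sub_mem_expDiffSubgroup_A (by decide) (by decide))
  have m7 : (((0 : Fin 2), (4 : Fin 12)) : BB.Mono 2 12) ∈ qc.expDiffSubgroup := by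
    have e : (((0 : Fin 2), (4 : Fin 12)) : BB.Mono 2 12) =
        ((0 : Fin 2), (0 : Fin 12)) + ((((0 : Fin 2), (6 : Fin 12))) - (0, 2)) := by decide
    rw [e]
    exact qc.expDiffSubgroup.add_mem m0 (qc.sub_mem_expDiffSubgroup_A (by decide) (by decide))
  have m8 : (((1 : Fin 2), (4 : Fin 12)) : BB.Mono 2 12) ∈ qc.expDiffSubgroup := by
    have e : (((1 : Fin 2), (4 : Fin 12)) : BB.Mono 2 12) =
        ((0 : Fin 2), (0 : Fin 12)) + ((((0 : Fin 2), (6 : Fin 12))) - (1, 2)) := by decide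
    rw [e]
    exact qc.expDiffSubgroup.add_mem m0 (qc.sub_mem_expDiffSubgroup_A (by decide) (by decide))
  have m9 : (((1 : Fin 2), (2 : Fin 12)) : BB.Mono 2 12) ∈ qc.expDiffSubgroup := by
    have e : (((1 : Fin 2), (2 : Fin 12)) : BB.Mono 2 12) =
        ((0 : Fin 2), (0 : Fin 12)) + ((((1 : Fin 2), (2 : Fin 12))) - (0, 0)) := by decide
    rw [e]
    exact qc.expDiffSubgroup.add_mem m0 (qc.sub_mem_expDiffSubgroup_A (by decide) (by decide))
  have m10 : (((1 : Fin 2), (8 : Fin 12)) : BB.Mono 2 12) ∈ qc.expDiffSubgroup := by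
    have e : (((1 : Fin 2), (8 : Fin 12)) : BB.Mono 2 12) =
        ((0 : Fin 2), (0 : Fin 12)) + ((((1 : Fin 2), (2 : Fin 12))) - (0, 6)) := by decide
    rw [e]
    exact qc.expDiffSubgroup.add_mem m0 (qc.sub_mem_expDiffSubgroup_A (by decide) (by decide))
  have m11 : (((1 : Fin 2), (6 : Fin 12)) : BB.Mono 2 12) ∈ qc.expDiffSubgroup := by
    have e : (((1 : Fin 2), (6 : Fin 12)) : BB.Mono 2 12) =
        ((0 : Fin 2), (10 : Fin 12)) + ((((1 : Fin 2), (2 : Fin 12))) - (0, 6)) := by decide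
    rw [e]
    exact qc.expDiffSubgroup.add_mem m1 (qc.sub_mem_expDiffSubgroup_A (by decide) (by decide))
  simp only [diffList, List.forall_mem_cons]
  exact ⟨m0, m4, m7, m2, m5, m1, m6, m9, m8, m11, m10, m3, by simp⟩

/-- `⟨S⟩ = diffSub` (`12` elements). -/
theorem expDiffSubgroup_eq : qc.expDiffSubgroup = diffSub :=
  le_antisymm expDiffSubgroup_le (fun x hx => diffList_le x hx)

set_option maxRecDepth 100000 in
/-- `|⟨S⟩| = 12`. -/
theorem card_expDiffSubgroup : Nat.card qc.expDiffSubgroup = 12 := by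
  rw [expDiffSubgroup_eq]
  change Nat.card {x : BB.Mono 2 12 // x ∈ diffList} = 12
  rw [Nat.card_eq_fintype_card]
  decide +kernel

set_option maxRecDepth 100000 in
/-- **The Tanner graph of `qc` has exactly `2` connected components** (BCGMRY24 Lemma 3 (ii): `#components · |⟨S⟩| = ℓm`,
`24 / 12 = 2`); with the tree's connected normal form (`TwoBlockConnectedComponents.lean`) the code is the disjoint union of
`2` copies of the root two-block code over `⟨S⟩` — numerically `2 × [[24, 8, 4]]`. KERNEL. -/
theorem qc_card_connectedComponent : Nat.card qc.css.tannerGraph.ConnectedComponent = 2 := by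
  have h := qc.card_connectedComponent_mul_card
    (fun h => absurd (congrFun h ((0 : Fin 2), (0 : Fin 12))) (by decide))
    (fun h => absurd (congrFun h ((0 : Fin 2), (0 : Fin 12))) (by decide))
  rw [card_expDiffSubgroup] at h
  omega

open scoped Classical in
/-- **`= 2 ×` a CONNECTED root code `[[24, 8, 4]]`, KERNEL** (not only numerically): the typed root two-block code of `qc`
over `⟨S⟩` (`BB.Code.rootCode`, `Literature/InformationTheory/QuantumCodes/TwoBlockRootParameters.lean`, base exponents the first monomials
of `A` and `B`) is a `[[24, 8, 4]]` code with a connected Tanner graph, and `2 ∣ 48`, `2 ∣ 16` (`BB.Code.rootCode_isCode` on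
`qc_isCode` and `qc_card_connectedComponent`). The root is NOT re-indexed to a named `QC(A', B')` here. -/
theorem root_isCode :
    (qc.rootCode (((0 : Fin 2), (0 : Fin 12)) : BB.Mono 2 12) ((0 : Fin 2), (0 : Fin 12))).IsCode 24 8 4 ∧
    (qc.rootCode (((0 : Fin 2), (0 : Fin 12)) : BB.Mono 2 12) ((0 : Fin 2), (0 : Fin 12))).tannerGraph.Connected ∧ 2 ∣ 48 ∧ 2 ∣ 16 :=
  qc.rootCode_isCode (by decide) (by decide) qc_isCode qc_card_connectedComponent

end Summit.Ventures.QEC.Census.SD8lc_n48_k16_503a67c3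

namespace Summit.Ventures.QEC.Census.SD8lc_n36_k10_ab93baab

open Matrix Literature.InformationTheory.QuantumCodes BBRows

/-- Monomials of `A = 1 + y + x + xy^2` (construction `A_terms = [[0, 0], [0, 1], [1, 0], [1, 2]]`, from the census generator file `census/search-3/gens/sd8/SD8lc_n36_k10_ab93baab.json` (matrix_sha256 `ab93baabf5a3d5b4…`; `A = 1+y+x+x*y^2`, `B = 1+y^5+x^2+x^2*y^4`)). DATA. -/
def la : List (BB.Mono 3 6) := [(Fin.ofNat 3 0, Fin.ofNat 6 0), (Fin.ofNat 3 0, Fin.ofNat 6 1), (Fin.ofNat 3 1, Fin.ofNat 6 0), (Fin.ofNat 3 1, Fin.ofNat 6 2)]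

/-- Monomials of `B = 1 + y^5 + x^2 + x^2y^4` (construction `B_terms = [[0, 0], [0, 5], [2, 0], [2, 4]]`). DATA. -/
def lb : List (BB.Mono 3 6) := [(Fin.ofNat 3 0, Fin.ofNat 6 0), (Fin.ofNat 3 0, Fin.ofNat 6 5), (Fin.ofNat 3 2, Fin.ofNat 6 0), (Fin.ofNat 3 2, Fin.ofNat 6 4)]

/-- The census row's code as a TYPED two-block code `QC(1 + y + x + xy^2, 1 + y^5 + x^2 + x^2y^4)` on `ℤ_3 × ℤ_6` (`BB.Code 3 6`). (definition) -/
def qc : BB.Code 3 6 := ⟨polyL la, polyL lb⟩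

set_option maxRecDepth 100000 in
/-- INDEX IDENTITY, `X` side, in the kernel: the certificate's `H^X` rows ARE the `X`-check words of `qc` (`decide +kernel`). -/
theorem HX_eq_rowsX : SD8lc_n36_k10_ab93baab.cert.HX = rowsX la lb := by
  decide +kernel

set_option maxRecDepth 100000 in
/-- INDEX IDENTITY, `Z` side. -/
theorem HZ_eq_rowsZ : SD8lc_n36_k10_ab93baab.cert.HZ = rowsZ la lb := by
  decide +kernel

set_option maxRecDepth 100000 in
/-- The certificate's flat `H^X` is `qc.HXFlat`. -/
theorem rowMatrix_HX_eq : rowMatrix 36 SD8lc_n36_k10_ab93baab.cert.HX = qc.HXFlat := by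
  have cast : ∀ {H H' : List ℕ} (e : H = H'),
      rowMatrix 36 H = (rowMatrix 36 H').submatrix (Fin.cast (congrArg List.length e)) id := by
    intro H H' e; subst e; rfl
  exact (cast HX_eq_rowsX).trans (rowMatrix_rowsX qc (LA := la) (LB := lb) rfl rfl)

set_option maxRecDepth 100000 in
/-- The certificate's flat `H^Z` is `qc.HZFlat`. -/
theorem rowMatrix_HZ_eq : rowMatrix 36 SD8lc_n36_k10_ab93baab.cert.HZ = qc.HZFlat := by
  have cast : ∀ {H H' : List ℕ} (e : H = H'),
      rowMatrix 36 H = (rowMatrix 36 H').submatrix (Fin.cast (congrArg List.length e)) id := by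
    intro H H' e; subst e; rfl
  exact (cast HZ_eq_rowsZ).trans (rowMatrix_rowsZ qc (LA := la) (LB := lb) rfl rfl)

set_option maxRecDepth 100000 in
/-- `d^Z (qc) = 4`, transported from the census certificate (`SD8lc_n36_k10_ab93baab.dZ_eq`) by `BB.Code.dZ_eq_of_flat`. -/
theorem qc_dZ : qc.css.dZ = 4 :=
  (qc.dZ_eq_of_flat (D := SD8lc_n36_k10_ab93baab.cert.code SD8lc_n36_k10_ab93baab.commOK_cert)
    rowMatrix_HX_eq rowMatrix_HZ_eq).symm.trans SD8lc_n36_k10_ab93baab.dZ_eq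

set_option maxRecDepth 100000 in
/-- `k (qc) = 10`, transported from the census certificate (`SD8lc_n36_k10_ab93baab.k_eq`) by `BB.Code.k_eq_of_flat`. -/
theorem qc_k : qc.k = 10 :=
  (qc.k_eq_of_flat (D := SD8lc_n36_k10_ab93baab.cert.code SD8lc_n36_k10_ab93baab.commOK_cert)
    rowMatrix_HX_eq rowMatrix_HZ_eq).symm.trans SD8lc_n36_k10_ab93baab.k_eq

/-- **`QC(1 + y + x + xy^2, 1 + y^5 + x^2 + x^2y^4)` on `ℤ_3 × ℤ_6` has parameters `[[36, 10, 4]]`** (distance exact; `BB.HasParams`) — the census row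
`SD8lc_n36_k10_ab93baab` read as a statement about the construction. KERNEL. -/
theorem qc_hasParams : Summit.Ventures.QEC.BB.HasParams qc 36 10 4 :=
  BB.hasParams_of_dZ (by simp only [BB.numQubits_eq]) qc_k qc_dZ

/-- The same in the generic census vocabulary: `qc.css.IsCode 36 10 4`. -/
theorem qc_isCode : qc.css.IsCode 36 10 4 :=
  (BB.hasParams_iff_isCode (by decide)).1 qc_hasParams

set_option maxRecDepth 100000 in
/-- **The Tanner graph of `qc` is connected** (Bravyi et al. 2024 Lemma 3 / `BB.Code.tannerGraph_connected_of_unit_mem`): `x = (1,0)`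
and `y = (0,1)` are explicit combinations of exponent differences inside `A` or inside `B` (found by qec-type-05's tools/conn_cert.py,
re-checked by `decide`). Census column «connected» for this row, KERNEL. -/
theorem qc_tannerGraph_connected : qc.css.tannerGraph.Connected := by
  refine qc.tannerGraph_connected_of_unit_mem (fun h => absurd (congrFun h ((0 : Fin 3), (0 : Fin 6))) (by decide))
    (fun h => absurd (congrFun h ((0 : Fin 3), (0 : Fin 6))) (by decide)) ?_ ?_
  · have e : (((1 : Fin 3), (0 : Fin 6)) : BB.Mono 3 6) = (2 : ℕ) • ((((0 : Fin 3), (0 : Fin 6))) - (1, 0)) := by decide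
    rw [e]
    exact (AddSubgroup.nsmul_mem _ (qc.sub_mem_expDiffSubgroup_A (by decide) (by decide)) 2)
  · have e : (((0 : Fin 3), (1 : Fin 6)) : BB.Mono 3 6) = (5 : ℕ) • ((((0 : Fin 3), (0 : Fin 6))) - (0, 1)) := by decide
    rw [e]
    exact (AddSubgroup.nsmul_mem _ (qc.sub_mem_expDiffSubgroup_A (by decide) (by decide)) 5)

/-- The two layout generators `A_iA_jᵀ ↦ (0, 0) − (0, 1)` and `B_gB_hᵀ ↦ (0, 0) − (2, 0)` generate `ℤ_3 × ℤ_6`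
(explicit multiples giving `x` and `y`, `decide`d). -/
theorem qc_layout_closure_eq_top : AddSubgroup.closure ({((0 : Fin 3), (0 : Fin 6)) - (0, 1), ((0 : Fin 3), (0 : Fin 6)) - (2, 0)} : Set (BB.Mono 3 6)) = ⊤ := by
  apply BB.Code.addSubgroup_eq_top_of_unit_mem
  · have h1 := AddSubgroup.subset_closure (k := ({((0 : Fin 3), (0 : Fin 6)) - (0, 1), ((0 : Fin 3), (0 : Fin 6)) - (2, 0)} : Set (BB.Mono 3 6))) (Set.mem_insert _ _)
    have h2 := AddSubgroup.subset_closure (k := ({((0 : Fin 3), (0 : Fin 6)) - (0, 1), ((0 : Fin 3), (0 : Fin 6)) - (2, 0)} : Set (BB.Mono 3 6))) (Set.mem_insert_of_mem _ rfl)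
    have e : (0 : ℕ) • (((0 : Fin 3), (0 : Fin 6)) - (0, 1)) + (1 : ℕ) • (((0 : Fin 3), (0 : Fin 6)) - (2, 0)) = (1, 0) := by decide
    have h' := AddSubgroup.add_mem _ (AddSubgroup.nsmul_mem _ h1 0) (AddSubgroup.nsmul_mem _ h2 1)
    rw [e] at h'
    exact h'
  · have h1 := AddSubgroup.subset_closure (k := ({((0 : Fin 3), (0 : Fin 6)) - (0, 1), ((0 : Fin 3), (0 : Fin 6)) - (2, 0)} : Set (BB.Mono 3 6))) (Set.mem_insert _ _)
    have h2 := AddSubgroup.subset_closure (k := ({((0 : Fin 3), (0 : Fin 6)) - (0, 1), ((0 : Fin 3), (0 : Fin 6)) - (2, 0)} : Set (BB.Mono 3 6))) (Set.mem_insert_of_mem _ rfl)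
    have e : (5 : ℕ) • (((0 : Fin 3), (0 : Fin 6)) - (0, 1)) + (0 : ℕ) • (((0 : Fin 3), (0 : Fin 6)) - (2, 0)) = (0, 1) := by decide
    have h' := AddSubgroup.add_mem _ (AddSubgroup.nsmul_mem _ h1 5) (AddSubgroup.nsmul_mem _ h2 0)
    rw [e] at h'
    exact h'

set_option maxRecDepth 100000 in
/-- Orders of the two layout generators: `6` and `3` (product `18 = ℓm`). -/
theorem qc_layout_orders : addOrderOf (((0 : Fin 3), (0 : Fin 6)) - (0, 1)) = 6 ∧ addOrderOf (((0 : Fin 3), (0 : Fin 6)) - (2, 0)) = 3 :=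
  ⟨(addOrderOf_eq_iff (by norm_num)).mpr (by decide), (addOrderOf_eq_iff (by norm_num)).mpr (by decide)⟩

/-- **`qc` has a toric layout with `(μ, λ) = (6, 3)`** (Bravyi et al. 2024 Lemma 4 / `BB.Code.hasToricLayoutWith_of_exponents`):
census layout column, KERNEL. -/
theorem qc_hasToricLayoutWith : HasToricLayoutWith 6 3 qc.css.tannerGraph := by
  have h := qc.hasToricLayoutWith_of_exponents (g := ((0 : Fin 3), (0 : Fin 6))) (g' := (0, 1))
    (h := ((0 : Fin 3), (0 : Fin 6))) (h' := (2, 0)) (by decide) (by decide) (by decide) (by decide)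
    qc_layout_closure_eq_top (by rw [qc_layout_orders.1, qc_layout_orders.2])
  rwa [qc_layout_orders.1, qc_layout_orders.2] at h

/-- `qc` has a toric layout. KERNEL. -/
theorem qc_hasToricLayout : HasToricLayout qc.css.tannerGraph :=
  ⟨6, 3, by norm_num, by norm_num, qc_hasToricLayoutWith⟩

end Summit.Ventures.QEC.Census.SD8lc_n36_k10_ab93baab
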